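import Literature.RepresentationTheory.GeneralLinear.SL2TripleCommutant
import HarnessLib

/-!
# The commutant of an `𝔰𝔩₂`-triple in isotypic position on a CORNER: compression to `range Q`, dimension
# `(rk P Q)²` of the corner commutant, scalar centre

Family `hodge`, layer `Literature/RepresentationTheory/GeneralLinear`; THEOREMS ONLY (no definition, no named fact;
D-0026).  Pure linear algebra over a field `K`, NO Hodge theory imported; written for the cell `pub-hodgecm2`
(COR-CM), seat `b27`, count-neutral lane MT-RANK-SIX-ISOGENY, where it is applied to the complexified Lie algebra of the
Hodge group of a weight-one Hodge structure whose derived algebra has dimension `3` and whose centre is arbitrary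
(`Motives/HodgeLieWeightOneSl2CenterSplitting`): there the `𝔰𝔩₂`-triple `(2P − 1, E, F)` is in isotypic position only
on the sub-space `range Q` cut out by a central idempotent `Q` (`E F = α P Q`, `F E = α (1 − P) Q`), the complement
`ker Q` being the part of the Hodge structure on which the derived algebra acts trivially.

SETTING.  `W` a finite-dimensional `K`-space; `P, E, F, Q ∈ End W`, `α ∈ Kˣ` with `Q² = Q`, `P Q = Q P`, `P² = P`,
`P E = E`, `E P = 0`, `P F = 0`, `F P = F`, `E Q = E = Q E`, `F Q = F = Q F`, `E F = α P Q`, `F E = α (Q − P Q)`; `C ⊆ End W`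
the COMMUTANT of `{P, E, F}` (hypothesis `hC`) and `D = {T ∈ C | T Q = T = Q T}` its corner at `Q` (hypothesis `hD`).
This file reduces the corner to the tree's `SL2TripleCommutant` (the case `Q = 1`) by COMPRESSION
`T ↦ ρ T ι` to `W₁ = range Q` (`ι` the inclusion, `ρ = Q` co-restricted; `ι ρ = Q`, `ρ ι = 1`):

* `compress_mul` — compression is multiplicative against operators commuting with `Q`; the compressed triple
  `(P₁, E₁, F₁)` is in isotypic position on `W₁` (`E₁ F₁ = α P₁`, `F₁ E₁ = α (1 − P₁)`), and compression restricts to a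
  linear isomorphism from `D` onto the commutant of `(P₁, E₁, F₁)` with inverse `S ↦ ι S ρ` (`exists_linearEquiv_corner`).
* **`finrank_corner_commutant_eq_sq`** — `dim_K D = (dim_K range (P Q))²`.
* **`exists_eq_smul_of_mem_center_corner_commutant`** — an element of `D` commuting with `D` is a scalar multiple of `Q`
  (`P Q ≠ 0`).

## References

* [FultonHarris1991] W. Fulton, J. Harris, *Representation Theory*, GTM 129 (1991), Lecture 11, §11.1 (isotypic
  `𝔰𝔩₂ℂ`-modules).
* [Humphreys1972] J. E. Humphreys, *Introduction to Lie Algebras and Representation Theory*, GTM 9 (1972), §6.1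
  (Schur's lemma), §7.2.
-/

namespace Literature.RepresentationTheory.GeneralLinear

universe u v

variable {K : Type u} [Field K] {W : Type v} [AddCommGroup W] [Module K W]

namespace SL2Triple

/-! ## §1 Compression to the range of an idempotent -/

section Compression

variable {Q : Module.End K W}

/-- `Q` is the identity on `range Q` for an idempotent `Q`. [cite: Humphreys1972, §6.1] -/
theorem apply_eq_self_of_mem_range (hQQ : Q * Q = Q) {w : W} (hw : w ∈ LinearMap.range Q) : Q w = w := by
  obtain ⟨u, rfl⟩ := hw
  rw [← Module.End.mul_apply, hQQ]

/-- `ρ (ι x) = x` on `range Q` (`ρ = Q` co-restricted to its range, `ι` the inclusion), `Q` idempotent.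
[cite: Humphreys1972, §6.1] -/
theorem rangeRestrict_subtype_apply (hQQ : Q * Q = Q) (x : LinearMap.range Q) :
    Q.rangeRestrict ((LinearMap.range Q).subtype x) = x := by
  apply Subtype.ext
  change Q (x : W) = x
  exact apply_eq_self_of_mem_range hQQ x.2

/-- `ι (ρ w) = Q w`. [cite: Humphreys1972, §6.1] -/
theorem subtype_rangeRestrict_apply (w : W) :
    (LinearMap.range Q).subtype (Q.rangeRestrict w) = Q w := rfl

/-- **Compression is multiplicative against an operator commuting with `Q`**:
`ρ (A B) ι = (ρ A ι) (ρ B ι)` when `B Q = Q B` (`ι ρ = Q`, `Q ι = ι`). [cite: Humphreys1972, §6.1] -/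
theorem compress_mul (hQQ : Q * Q = Q) (A : Module.End K W) {B : Module.End K W} (hB : B * Q = Q * B) :
    Q.rangeRestrict ∘ₗ (A * B) ∘ₗ (LinearMap.range Q).subtype =
      (Q.rangeRestrict ∘ₗ A ∘ₗ (LinearMap.range Q).subtype) *
        (Q.rangeRestrict ∘ₗ B ∘ₗ (LinearMap.range Q).subtype) := by
  refine LinearMap.ext fun x => Subtype.ext ?_
  change Q ((A * B) (x : W)) = Q (A ((LinearMap.range Q).subtype (Q.rangeRestrict (B (x : W)))))
  rw [subtype_rangeRestrict_apply, ← Module.End.mul_apply Q B, ← hB, Module.End.mul_apply, Module.End.mul_apply,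
    apply_eq_self_of_mem_range hQQ x.2]

/-- Compression of `Q` itself is the identity of `range Q`. [cite: Humphreys1972, §6.1] -/
theorem compress_self (hQQ : Q * Q = Q) :
    Q.rangeRestrict ∘ₗ Q ∘ₗ (LinearMap.range Q).subtype = 1 := by
  refine LinearMap.ext fun x => Subtype.ext ?_
  change Q (Q (x : W)) = x
  rw [apply_eq_self_of_mem_range hQQ x.2, apply_eq_self_of_mem_range hQQ x.2]

/-- Compression of `1` is the identity of `range Q`. [cite: Humphreys1972, §6.1] -/
theorem compress_one (hQQ : Q * Q = Q) :
    Q.rangeRestrict ∘ₗ (1 : Module.End K W) ∘ₗ (LinearMap.range Q).subtype = 1 := by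
  refine LinearMap.ext fun x => Subtype.ext ?_
  change Q ((x : W)) = x
  exact apply_eq_self_of_mem_range hQQ x.2

/-- Compression is additive. [cite: Humphreys1972, §6.1] -/
theorem compress_add (A B : Module.End K W) :
    Q.rangeRestrict ∘ₗ (A + B) ∘ₗ (LinearMap.range Q).subtype =
      Q.rangeRestrict ∘ₗ A ∘ₗ (LinearMap.range Q).subtype + Q.rangeRestrict ∘ₗ B ∘ₗ (LinearMap.range Q).subtype := by
  rw [LinearMap.add_comp, LinearMap.comp_add]

/-- Compression is homogeneous. [cite: Humphreys1972, §6.1] -/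
theorem compress_smul (c : K) (A : Module.End K W) :
    Q.rangeRestrict ∘ₗ (c • A) ∘ₗ (LinearMap.range Q).subtype =
      c • (Q.rangeRestrict ∘ₗ A ∘ₗ (LinearMap.range Q).subtype) := by
  rw [LinearMap.smul_comp, LinearMap.comp_smul]

/-- Compression of `A − B`. [cite: Humphreys1972, §6.1] -/
theorem compress_sub (A B : Module.End K W) :
    Q.rangeRestrict ∘ₗ (A - B) ∘ₗ (LinearMap.range Q).subtype =
      Q.rangeRestrict ∘ₗ A ∘ₗ (LinearMap.range Q).subtype - Q.rangeRestrict ∘ₗ B ∘ₗ (LinearMap.range Q).subtype := by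
  rw [LinearMap.sub_comp, LinearMap.comp_sub]

/-- **Decompression**: `ι (ρ A ι) ρ = Q A Q`. [cite: Humphreys1972, §6.1] -/
theorem subtype_comp_compress_comp_rangeRestrict (A : Module.End K W) :
    (LinearMap.range Q).subtype ∘ₗ (Q.rangeRestrict ∘ₗ A ∘ₗ (LinearMap.range Q).subtype) ∘ₗ Q.rangeRestrict =
      Q * A * Q := by
  refine LinearMap.ext fun w => ?_
  rfl

/-- `ρ (ι S ρ) ι = S` for an endomorphism `S` of `range Q` (`Q` idempotent). [cite: Humphreys1972, §6.1] -/
theorem compress_lift (hQQ : Q * Q = Q) (S : Module.End K (LinearMap.range Q)) :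
    Q.rangeRestrict ∘ₗ ((LinearMap.range Q).subtype ∘ₗ S ∘ₗ Q.rangeRestrict) ∘ₗ (LinearMap.range Q).subtype = S := by
  refine LinearMap.ext fun x => ?_
  change Q.rangeRestrict ((LinearMap.range Q).subtype (S (Q.rangeRestrict ((LinearMap.range Q).subtype x)))) = S x
  rw [rangeRestrict_subtype_apply hQQ, rangeRestrict_subtype_apply hQQ]

/-- The lift `ι S ρ` is absorbed by `Q` on both sides: `(ι S ρ) Q = ι S ρ = Q (ι S ρ)`. [cite: Humphreys1972, §6.1] -/
theorem lift_mul_eq (hQQ : Q * Q = Q) (S : Module.End K (LinearMap.range Q)) :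
    ((LinearMap.range Q).subtype ∘ₗ S ∘ₗ Q.rangeRestrict) * Q = (LinearMap.range Q).subtype ∘ₗ S ∘ₗ Q.rangeRestrict ∧
      Q * ((LinearMap.range Q).subtype ∘ₗ S ∘ₗ Q.rangeRestrict) =
        (LinearMap.range Q).subtype ∘ₗ S ∘ₗ Q.rangeRestrict := by
  constructor
  · refine LinearMap.ext fun w => ?_
    change (LinearMap.range Q).subtype (S (Q.rangeRestrict (Q w))) = (LinearMap.range Q).subtype (S (Q.rangeRestrict w))
    have h : Q.rangeRestrict (Q w) = Q.rangeRestrict w := by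
      apply Subtype.ext
      change Q (Q w) = Q w
      rw [← Module.End.mul_apply, hQQ]
    rw [h]
  · refine LinearMap.ext fun w => ?_
    change Q ((S (Q.rangeRestrict w) : LinearMap.range Q) : W) = (S (Q.rangeRestrict w) : W)
    exact apply_eq_self_of_mem_range hQQ (S (Q.rangeRestrict w)).2

end Compression

/-! ## §2 The corner commutant is the commutant of the compressed triple -/

section Corner

variable {P E F Q : Module.End K W} {α : K}

/-- **The corner commutant `D = {T ∈ C | T Q = T = Q T}` is linearly isomorphic, by compression, to the commutant of the
compressed triple `(P₁, E₁, F₁)` on `range Q`**, which is in isotypic position (`E₁ F₁ = α P₁`, `F₁ E₁ = α (1 − P₁)`):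
compression is multiplicative on operators commuting with `Q`, the lift `S ↦ ι S ρ` is inverse to it on `D`, and
`dim range P₁ = dim range (P Q)`.  Packaged as an existence statement (no definition is introduced).
[cite: FultonHarris1991, Lecture 11 (§11.1)] [cite: Humphreys1972, §6.1] -/
theorem exists_linearEquiv_corner (hQQ : Q * Q = Q) (hPQ : P * Q = Q * P)
    (hPP : P * P = P) (hPE : P * E = E) (hEP : E * P = 0) (hPF : P * F = 0) (hFP : F * P = F)
    (hEQ : E * Q = E) (hQE : Q * E = E) (hFQ : F * Q = F) (hQF : Q * F = F)
    (hEF : E * F = α • (P * Q)) (hFE : F * E = α • (Q - P * Q))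
    {C : Submodule K (Module.End K W)} (hC : ∀ T, T ∈ C ↔ T * P = P * T ∧ T * E = E * T ∧ T * F = F * T)
    {D : Submodule K (Module.End K W)} (hD : ∀ T, T ∈ D ↔ T ∈ C ∧ T * Q = T ∧ Q * T = T) :
    ∃ (P₁ E₁ F₁ : Module.End K (LinearMap.range Q)) (C₁ : Submodule K (Module.End K (LinearMap.range Q)))
      (Φ : D ≃ₗ[K] C₁),
      P₁ * P₁ = P₁ ∧ P₁ * E₁ = E₁ ∧ E₁ * P₁ = 0 ∧ P₁ * F₁ = 0 ∧ F₁ * P₁ = F₁ ∧ E₁ * F₁ = α • P₁ ∧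
      F₁ * E₁ = α • (1 - P₁) ∧
      (∀ S, S ∈ C₁ ↔ S * P₁ = P₁ * S ∧ S * E₁ = E₁ * S ∧ S * F₁ = F₁ * S) ∧
      (∀ T : D, (Φ T : Module.End K (LinearMap.range Q)) =
        Q.rangeRestrict ∘ₗ (T : Module.End K W) ∘ₗ (LinearMap.range Q).subtype) ∧
      (∀ S : C₁, ((Φ.symm S : D) : Module.End K W) =
        (LinearMap.range Q).subtype ∘ₗ (S : Module.End K (LinearMap.range Q)) ∘ₗ Q.rangeRestrict) ∧
      (LinearMap.range P₁).map (LinearMap.range Q).subtype = LinearMap.range (P * Q) ∧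
      Module.finrank K (LinearMap.range P₁) = Module.finrank K (LinearMap.range (P * Q)) := by
  -- the compressed operators
  set ι := (LinearMap.range Q).subtype with hι
  set ρ := Q.rangeRestrict with hρ
  set P₁ : Module.End K (LinearMap.range Q) := ρ ∘ₗ P ∘ₗ ι with hP₁
  set E₁ : Module.End K (LinearMap.range Q) := ρ ∘ₗ E ∘ₗ ι with hE₁
  set F₁ : Module.End K (LinearMap.range Q) := ρ ∘ₗ F ∘ₗ ι with hF₁
  have hEQ' : E * Q = Q * E := by rw [hEQ, hQE]
  have hFQ' : F * Q = Q * F := by rw [hFQ, hQF]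
  -- the isotypic identities on `range Q`
  have h11 : P₁ * P₁ = P₁ := by rw [hP₁, ← compress_mul hQQ P hPQ, hPP]
  have h12 : P₁ * E₁ = E₁ := by rw [hP₁, hE₁, ← compress_mul hQQ P hEQ', hPE]
  have h13 : E₁ * P₁ = 0 := by
    rw [hE₁, hP₁, ← compress_mul hQQ E hPQ, hEP, LinearMap.zero_comp, LinearMap.comp_zero]
  have h14 : P₁ * F₁ = 0 := by
    rw [hP₁, hF₁, ← compress_mul hQQ P hFQ', hPF, LinearMap.zero_comp, LinearMap.comp_zero]
  have h15 : F₁ * P₁ = F₁ := by rw [hF₁, hP₁, ← compress_mul hQQ F hPQ, hFP]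
  have h16 : E₁ * F₁ = α • P₁ := by
    rw [hE₁, hF₁, ← compress_mul hQQ E hFQ', hEF, compress_smul, compress_mul hQQ P rfl, compress_self hQQ, mul_one]
  have h17 : F₁ * E₁ = α • (1 - P₁) := by
    rw [hF₁, hE₁, ← compress_mul hQQ F hEQ', hFE, compress_smul, compress_sub, compress_self hQQ,
      compress_mul hQQ P rfl, compress_self hQQ, mul_one]
  -- the commutant on `range Q`
  set C₁ : Submodule K (Module.End K (LinearMap.range Q)) :=
    LinearMap.ker (LinearMap.mulRight K P₁ - LinearMap.mulLeft K P₁) ⊓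
      LinearMap.ker (LinearMap.mulRight K E₁ - LinearMap.mulLeft K E₁) ⊓
      LinearMap.ker (LinearMap.mulRight K F₁ - LinearMap.mulLeft K F₁) with hC₁def
  have hC₁ : ∀ S, S ∈ C₁ ↔ S * P₁ = P₁ * S ∧ S * E₁ = E₁ * S ∧ S * F₁ = F₁ * S := by
    intro S
    simp only [hC₁def, Submodule.mem_inf, LinearMap.mem_ker, LinearMap.sub_apply, LinearMap.mulRight_apply,
      LinearMap.mulLeft_apply, sub_eq_zero, and_assoc]
  -- compression maps `D` into `C₁`
  have hcompC : ∀ T : Module.End K W, T ∈ D → ρ ∘ₗ T ∘ₗ ι ∈ C₁ := by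
    intro T hT
    obtain ⟨hTC, hTQ, hQT⟩ := (hD T).1 hT
    obtain ⟨hTP, hTE, hTF⟩ := (hC T).1 hTC
    have hTQ' : T * Q = Q * T := by rw [hTQ, hQT]
    rw [hC₁]
    refine ⟨?_, ?_, ?_⟩
    · rw [hP₁, ← compress_mul hQQ T hPQ, hTP, compress_mul hQQ P hTQ']
    · rw [hE₁, ← compress_mul hQQ T hEQ', hTE, compress_mul hQQ E hTQ']
    · rw [hF₁, ← compress_mul hQQ T hFQ', hTF, compress_mul hQQ F hTQ']
  -- intertwining of the structure maps with `ι` and `ρ`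
  have hιA : ∀ {A : Module.End K W}, A * Q = Q * A → ι ∘ₗ (ρ ∘ₗ A ∘ₗ ι) = A ∘ₗ ι := by
    intro A hA
    refine LinearMap.ext fun x => ?_
    change Q (A (x : W)) = A (x : W)
    have hx : Q (x : W) = x := apply_eq_self_of_mem_range hQQ x.2
    rw [← Module.End.mul_apply, ← hA, Module.End.mul_apply, hx]
  have hρA : ∀ {A : Module.End K W}, A * Q = Q * A → (ρ ∘ₗ A ∘ₗ ι) ∘ₗ ρ = ρ ∘ₗ A := by
    intro A hA
    refine LinearMap.ext fun w => Subtype.ext ?_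
    change Q (A (Q w)) = Q (A w)
    rw [← Module.End.mul_apply A Q, hA, Module.End.mul_apply, ← Module.End.mul_apply Q Q, hQQ]
  -- the lift maps `C₁` into `D`
  have hliftD : ∀ S : Module.End K (LinearMap.range Q), S ∈ C₁ → ι ∘ₗ S ∘ₗ ρ ∈ D := by
    intro S hS
    obtain ⟨hSP, hSE, hSF⟩ := (hC₁ S).1 hS
    have key : ∀ {A : Module.End K W}, A * Q = Q * A → S * (ρ ∘ₗ A ∘ₗ ι) = (ρ ∘ₗ A ∘ₗ ι) * S →
        (ι ∘ₗ S ∘ₗ ρ) * A = A * (ι ∘ₗ S ∘ₗ ρ) := by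
      intro A hA hSA
      calc (ι ∘ₗ S ∘ₗ ρ) * A = ι ∘ₗ S ∘ₗ (ρ ∘ₗ A) := by rfl
        _ = ι ∘ₗ S ∘ₗ ((ρ ∘ₗ A ∘ₗ ι) ∘ₗ ρ) := by rw [hρA hA]
        _ = ι ∘ₗ (S * (ρ ∘ₗ A ∘ₗ ι)) ∘ₗ ρ := by rfl
        _ = ι ∘ₗ ((ρ ∘ₗ A ∘ₗ ι) * S) ∘ₗ ρ := by rw [hSA]
        _ = (ι ∘ₗ (ρ ∘ₗ A ∘ₗ ι)) ∘ₗ S ∘ₗ ρ := by rfl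
        _ = (A ∘ₗ ι) ∘ₗ S ∘ₗ ρ := by rw [hιA hA]
        _ = A * (ι ∘ₗ S ∘ₗ ρ) := by rfl
    obtain ⟨hl1, hl2⟩ := lift_mul_eq hQQ S
    rw [hD, hC]
    exact ⟨⟨key hPQ hSP, key hEQ' hSE, key hFQ' hSF⟩, hl1, hl2⟩
  -- the linear equivalence
  let Φ : D ≃ₗ[K] C₁ :=
    { toFun := fun T => ⟨ρ ∘ₗ (T : Module.End K W) ∘ₗ ι, hcompC T T.2⟩
      map_add' := fun T T' => by
        apply Subtype.ext
        change ρ ∘ₗ ((T : Module.End K W) + (T' : Module.End K W)) ∘ₗ ι =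
          ρ ∘ₗ (T : Module.End K W) ∘ₗ ι + ρ ∘ₗ (T' : Module.End K W) ∘ₗ ι
        exact compress_add _ _
      map_smul' := fun c T => by
        apply Subtype.ext
        change ρ ∘ₗ (c • (T : Module.End K W)) ∘ₗ ι = c • (ρ ∘ₗ (T : Module.End K W) ∘ₗ ι)
        exact compress_smul _ _
      invFun := fun S => ⟨ι ∘ₗ (S : Module.End K (LinearMap.range Q)) ∘ₗ ρ, hliftD S S.2⟩
      left_inv := fun T => by
        apply Subtype.ext
        obtain ⟨-, hTQ, hQT⟩ := (hD T).1 T.2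
        change ι ∘ₗ (ρ ∘ₗ (T : Module.End K W) ∘ₗ ι) ∘ₗ ρ = (T : Module.End K W)
        rw [subtype_comp_compress_comp_rangeRestrict, hQT, hTQ]
      right_inv := fun S => by
        apply Subtype.ext
        change ρ ∘ₗ (ι ∘ₗ (S : Module.End K (LinearMap.range Q)) ∘ₗ ρ) ∘ₗ ι = (S : Module.End K (LinearMap.range Q))
        exact compress_lift hQQ _ }
  -- `range P₁` versus `range (P Q)`: `ι` maps the former onto the latter
  have hmap : (LinearMap.range P₁).map ι = LinearMap.range (P * Q) := by
    apply le_antisymm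
    · rintro _ ⟨_, ⟨x, rfl⟩, rfl⟩
      obtain ⟨u, hu⟩ := x.2
      refine ⟨u, ?_⟩
      change (P * Q) u = Q (P (x : W))
      rw [← Module.End.mul_apply Q P, ← hPQ, Module.End.mul_apply, Module.End.mul_apply,
        apply_eq_self_of_mem_range hQQ x.2, hu]
    · rintro _ ⟨u, rfl⟩
      refine ⟨P₁ (ρ u), LinearMap.mem_range_self _ _, ?_⟩
      change Q (P (Q u)) = (P * Q) u
      rw [← Module.End.mul_apply Q P, ← hPQ, Module.End.mul_apply, Module.End.mul_apply, ← Module.End.mul_apply Q Q,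
        hQQ]
  have hfin : Module.finrank K (LinearMap.range P₁) = Module.finrank K (LinearMap.range (P * Q)) := by
    rw [← hmap]
    exact LinearEquiv.finrank_eq (Submodule.equivMapOfInjective ι (Submodule.injective_subtype _) (LinearMap.range P₁))
  exact ⟨P₁, E₁, F₁, C₁, Φ, h11, h12, h13, h14, h15, h16, h17, hC₁, fun T => rfl, fun S => rfl, hmap, hfin⟩

/-! ## §3 Dimension and centre of the corner commutant -/

/-- **`dim_K D = (dim_K range (P Q))²`** for the corner `D = {T ∈ C | T Q = T = Q T}` of the commutant `C` of
`{P, E, F}`, when `(P, E, F)` is an `𝔰𝔩₂`-triple in isotypic position on `range Q` (`E F = α P Q`, `F E = α (Q − P Q)`,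
`E, F` absorbed by the central idempotent `Q`): compression identifies `D` with the commutant of the compressed triple
on `range Q`, which is `End(range P Q)` (`finrank_commutant_eq_sq`). [cite: FultonHarris1991, Lecture 11 (§11.1)]
[cite: Humphreys1972, §6.1 and §7.2] -/
theorem finrank_corner_commutant_eq_sq [FiniteDimensional K W] (hα : α ≠ 0) (hQQ : Q * Q = Q)
    (hPQ : P * Q = Q * P)
    (hPP : P * P = P) (hPE : P * E = E) (hEP : E * P = 0) (hPF : P * F = 0) (hFP : F * P = F)
    (hEQ : E * Q = E) (hQE : Q * E = E) (hFQ : F * Q = F) (hQF : Q * F = F)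
    (hEF : E * F = α • (P * Q)) (hFE : F * E = α • (Q - P * Q))
    {C : Submodule K (Module.End K W)} (hC : ∀ T, T ∈ C ↔ T * P = P * T ∧ T * E = E * T ∧ T * F = F * T)
    {D : Submodule K (Module.End K W)} (hD : ∀ T, T ∈ D ↔ T ∈ C ∧ T * Q = T ∧ Q * T = T) :
    Module.finrank K D = Module.finrank K (LinearMap.range (P * Q)) ^ 2 := by
  obtain ⟨P₁, E₁, F₁, C₁, Φ, h11, h12, h13, h14, h15, h16, h17, hC₁, -, -, -, hfin⟩ :=
    exists_linearEquiv_corner hQQ hPQ hPP hPE hEP hPF hFP hEQ hQE hFQ hQF hEF hFE hC hD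
  rw [Φ.finrank_eq, finrank_commutant_eq_sq hα h11 h12 h13 h14 h15 h16 h17 hC₁, hfin]

/-- **An element of the corner commutant commuting with the corner commutant is a scalar multiple of `Q`**
(`P Q ≠ 0`): its compression is central in the commutant of the compressed triple on `range Q`, hence a scalar there
(`exists_eq_smul_one_of_mem_center_commutant`), and `T = Q T Q = ι (ρ T ι) ρ = c · Q`.
[cite: Humphreys1972, §6.1] [cite: FultonHarris1991, Lecture 11 (§11.1)] -/
theorem exists_eq_smul_of_mem_center_corner_commutant (hα : α ≠ 0) (hQQ : Q * Q = Q) (hPQ : P * Q = Q * P)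
    (hPP : P * P = P) (hPE : P * E = E) (hEP : E * P = 0) (hPF : P * F = 0) (hFP : F * P = F)
    (hEQ : E * Q = E) (hQE : Q * E = E) (hFQ : F * Q = F) (hQF : Q * F = F)
    (hEF : E * F = α • (P * Q)) (hFE : F * E = α • (Q - P * Q)) (hPQ0 : P * Q ≠ 0)
    {C : Submodule K (Module.End K W)} (hC : ∀ T, T ∈ C ↔ T * P = P * T ∧ T * E = E * T ∧ T * F = F * T)
    {D : Submodule K (Module.End K W)} (hD : ∀ T, T ∈ D ↔ T ∈ C ∧ T * Q = T ∧ Q * T = T)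
    {T : Module.End K W} (hT : T ∈ D) (hcomm : ∀ T' ∈ D, T * T' = T' * T) :
    ∃ c : K, T = c • Q := by
  obtain ⟨P₁, E₁, F₁, C₁, Φ, h11, h12, h13, h14, h15, h16, h17, hC₁, hΦ, hΦs, hmap, -⟩ :=
    exists_linearEquiv_corner hQQ hPQ hPP hPE hEP hPF hFP hEQ hQE hFQ hQF hEF hFE hC hD
  set ι := (LinearMap.range Q).subtype with hι
  set ρ := Q.rangeRestrict with hρ
  obtain ⟨-, hTQ, hQT⟩ := (hD T).1 hT
  have hTQ' : T * Q = Q * T := by rw [hTQ, hQT]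
  -- `P₁ ≠ 0`
  have hP₁ : P₁ ≠ 0 := by
    intro h0
    apply hPQ0
    have hr : LinearMap.range (P * Q) = ⊥ := by rw [← hmap, h0, LinearMap.range_zero, Submodule.map_bot]
    exact LinearMap.range_eq_bot.1 hr
  -- the compression of `T` is central in `C₁`
  set T₁ : C₁ := Φ ⟨T, hT⟩ with hT₁def
  have hT₁ : (T₁ : Module.End K (LinearMap.range Q)) = ρ ∘ₗ T ∘ₗ ι := hΦ ⟨T, hT⟩
  have hcen : ∀ S ∈ C₁, (T₁ : Module.End K (LinearMap.range Q)) * S = S * T₁ := by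
    intro S hS
    have hSD := (Φ.symm ⟨S, hS⟩).2
    have hSval : ((Φ.symm ⟨S, hS⟩ : D) : Module.End K W) = ι ∘ₗ S ∘ₗ ρ := hΦs ⟨S, hS⟩
    obtain ⟨-, hLQ, hQL⟩ := (hD _).1 hSD
    rw [hSval] at hLQ hQL hSD
    have hLQ' : (ι ∘ₗ S ∘ₗ ρ) * Q = Q * (ι ∘ₗ S ∘ₗ ρ) := by rw [hLQ, hQL]
    have h := hcomm _ hSD
    -- compress the commutation relation
    have h' : ρ ∘ₗ (T * (ι ∘ₗ S ∘ₗ ρ)) ∘ₗ ι = ρ ∘ₗ ((ι ∘ₗ S ∘ₗ ρ) * T) ∘ₗ ι := by rw [h]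
    rw [compress_mul hQQ T hLQ', compress_mul hQQ _ hTQ', compress_lift hQQ] at h'
    rw [hT₁]
    exact h'
  obtain ⟨c, hc⟩ := exists_eq_smul_one_of_mem_center_commutant hα h11 h12 h13 h14 h15 h16 h17 hP₁ hC₁ T₁.2 hcen
  refine ⟨c, ?_⟩
  -- decompress: `T = Q T Q = ι (ρ T ι) ρ = c • Q`
  have hdec : ι ∘ₗ (ρ ∘ₗ T ∘ₗ ι) ∘ₗ ρ = T := by
    rw [hι, hρ, subtype_comp_compress_comp_rangeRestrict, hQT, hTQ]
  rw [← hdec, ← hT₁, hc, LinearMap.smul_comp, LinearMap.comp_smul]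
  congr 1

end Corner

end SL2Triple

end Literature.RepresentationTheory.GeneralLinear
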